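import Summits.ResolutionOfSingularities.ResolutionOfSingularities.Theorems.EquisingularLiftEquisingularLiftNatKeyLetterIncidence
import HarnessLib

/-!
# [OURS · L1 W4.5(b) · EL♮(3) · WIDTH TABLE D5 «IMMATURE HOST», supplier row HOPEN, input (IN-3)] G1-CAR — THE KEY LETTER'S INCIDENCE AFTER THE CARRIER PAIR ROUND
# `TCPlus.keyInc_carrierRound : … → St' 𝓜₁ ≤ (𝓢 ⊔ 𝓟)·𝒪_{X₂} ⊔ St' 𝓠` (res-L1-w45b-stub-2 g16's pinned shape, STATUS 2026-08-28T22:00:03Z)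

res-L1-w45b-stub-4 g12 (desk R54 / l.83769: «(IN-2) G1-P / (IN-3) G1-CAR instantiations of ✓ p670257 → stub-4»).  OURS; NOT a statement of any manuscript
([Hironaka2017] is a candidate under adjudication, nothing of it is asserted); AI-written, weaker than expert review.  No `sorry`; standard axioms; DEF-FREE.
`--supports stmt-ResolutionOfSingularities-20148 --as helper`.

WHAT.  The CAR move of the opening (`OpeningCertKeyLetter`, ✓ Defs8 p671016): the pair round blows up the centre `𝒞 = 𝓢 ⊔ 𝓟` (carrier plane's model `𝓢` = the first
exceptional, host letter `𝓟 = St 𝓛h`), `τ' = Bl_𝒞`, exceptional `𝓔₁ = 𝒞·𝒪_{X₂}`.  The immature key letter `𝓜₁ = St 𝓜` carries the G1-P incidence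
`𝓜₁ ≤ 𝓟^a ⊔ 𝓟·𝓢 ⊔ 𝓢·𝓠` (`𝓠 = St 𝓛j`, `2 ≤ a`) and has generic order EXACTLY ONE along `𝒞` — in the form HOPEN produces it, the FACTORIZATION
`𝓜₁·𝒪_{X₂} = 𝓔₁ · St' 𝓜₁` (res-L1-w45b-stub-4's ✓ `comap_eq_pow_mul_strictTransformIdeal_of_packs` fed with Δ2b's packs, inside HOPEN).  CONCLUSION (the φ_q TAG
`(St²M; E₁, St²Λ)` upstairs): `St' 𝓜₁ ≤ 𝓔₁ ⊔ St' 𝓠`.  PROOF (the G1 calculus ✓ p670257 in three monomials, written out): pulling the incidence back,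
`𝓜₁·𝒪 ≤ 𝓔₁^a ⊔ 𝓔₁² ⊔ 𝓔₁·St'𝓠 ≤ 𝓔₁·(𝓔₁ ⊔ St'𝓠)` (`𝓟·𝒪, 𝓢·𝒪 ≤ 𝓔₁`, `𝓠·𝒪 ≤ St'𝓠`, `a ≥ 2`), and the effective Cartier factor `𝓔₁` cancels against the
factorization (Literature `IsEffectiveCartier.le_of_mul_le_mul`).  For `a = 1` the term `𝓟·𝒪 ≤ 𝓔₁` survives uncancelled and the tag is false (stub-2's (A1)).
[folklore; pure ideal-sheaf algebra over the cited tree lemmas]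
-/

set_option linter.dupNamespace false
set_option linter.overlappingInstances false

noncomputable section

open CategoryTheory AlgebraicGeometry TopologicalSpace
open Literature.AlgebraicGeometry.Resolution
open AlgebraicGeometry.Scheme.IdealSheafData

namespace Summit.ResolutionOfSingularities.ResolutionOfSingularities.Cruxes.EquisingularLiftNat.Sections

/-- **G1-CAR, pure form**: for any morphism `τ'` with `𝓔 := (𝓢 ⊔ 𝓟)·𝒪` effective Cartier, an ideal sheaf `𝓜₁ ≤ 𝓟^a ⊔ 𝓟·𝓢 ⊔ 𝓢·𝓠` with `2 ≤ a` whose total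
transform factors as `𝓔 · St' 𝓜₁` satisfies `St' 𝓜₁ ≤ 𝓔 ⊔ St' 𝓠`. [folklore; ideal-sheaf algebra] [OURS · L1 W4.5b · WIDTH TABLE D5, HOPEN (IN-3)] -/
theorem keyInc_carrierRound_of_factorization {X₁ X₂ : Scheme.{0}} (τ' : X₂ ⟶ X₁) (𝓢 𝓟 𝓠 𝓜₁ : X₁.IdealSheafData) {a : ℕ} (ha : 2 ≤ a)
    (h𝓔 : IsEffectiveCartier ((𝓢 ⊔ 𝓟).comap τ')) (hInc : 𝓜₁ ≤ 𝓟 ^ a ⊔ 𝓟 * 𝓢 ⊔ 𝓢 * 𝓠)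
    (hfac : 𝓜₁.comap τ' = (𝓢 ⊔ 𝓟).comap τ' ^ 1 * strictTransformIdeal τ' (𝓢 ⊔ 𝓟) 𝓜₁) :
    strictTransformIdeal τ' (𝓢 ⊔ 𝓟) 𝓜₁ ≤ (𝓢 ⊔ 𝓟).comap τ' ⊔ strictTransformIdeal τ' (𝓢 ⊔ 𝓟) 𝓠 := by
  set 𝓔 := (𝓢 ⊔ 𝓟).comap τ' with h𝓔def
  have hP : 𝓟.comap τ' ≤ 𝓔 := Scheme.IdealSheafData.comap_mono τ' (le_sup_right : 𝓟 ≤ 𝓢 ⊔ 𝓟)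
  have hS : 𝓢.comap τ' ≤ 𝓔 := Scheme.IdealSheafData.comap_mono τ' (le_sup_left : 𝓢 ≤ 𝓢 ⊔ 𝓟)
  have hQ : 𝓠.comap τ' ≤ strictTransformIdeal τ' (𝓢 ⊔ 𝓟) 𝓠 := comap_le_strictTransformIdeal τ' _ 𝓠
  have hEa : 𝓔 ^ a ≤ 𝓔 * 𝓔 := by
    calc 𝓔 ^ a = 𝓔 ^ (a - 2) * 𝓔 ^ 2 := by rw [← pow_add, Nat.sub_add_cancel ha]
      _ ≤ 𝓔 ^ 2 := pow_mul_le 𝓔 (𝓔 ^ 2) (a - 2)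
      _ = 𝓔 * 𝓔 := pow_two 𝓔
  apply h𝓔.le_of_mul_le_mul
  calc 𝓔 * strictTransformIdeal τ' (𝓢 ⊔ 𝓟) 𝓜₁ = 𝓜₁.comap τ' := by rw [hfac, pow_one]
    _ ≤ (𝓟 ^ a ⊔ 𝓟 * 𝓢 ⊔ 𝓢 * 𝓠).comap τ' := Scheme.IdealSheafData.comap_mono τ' hInc
    _ = 𝓟.comap τ' ^ a ⊔ 𝓟.comap τ' * 𝓢.comap τ' ⊔ 𝓢.comap τ' * 𝓠.comap τ' := by
        rw [Scheme.IdealSheafData.comap_sup, Scheme.IdealSheafData.comap_sup, comap_mul, comap_mul, comap_pow]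
    _ ≤ 𝓔 ^ a ⊔ 𝓔 * 𝓔 ⊔ 𝓔 * strictTransformIdeal τ' (𝓢 ⊔ 𝓟) 𝓠 :=
        sup_le_sup (sup_le_sup (pow_le_pow_left' hP a) (mul_le_mul' hP hS)) (mul_le_mul' hS hQ)
    _ ≤ 𝓔 * 𝓔 ⊔ 𝓔 * 𝓔 ⊔ 𝓔 * strictTransformIdeal τ' (𝓢 ⊔ 𝓟) 𝓠 := sup_le_sup (sup_le_sup hEa le_rfl) le_rfl
    _ = 𝓔 * (𝓔 ⊔ strictTransformIdeal τ' (𝓢 ⊔ 𝓟) 𝓠) := by rw [sup_idem]; exact (mul_add 𝓔 𝓔 _).symm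

/-- **(IN-3) G1-CAR in res-L1-w45b-stub-2's pinned shape** (HOPEN part 2 binder `hG1C`): at a regular integral stage `X₁` over the DVR `O`, for the CAR pair round
`τ' = Bl_{𝓢 ⊔ 𝓟}` and the immature key letter `𝓜₁ ≤ 𝓟^a ⊔ 𝓟·𝓢 ⊔ 𝓢·𝓠` (`2 ≤ a`) with the order-one factorization `𝓜₁·𝒪 = (𝓢 ⊔ 𝓟)·𝒪 · St' 𝓜₁`:
`St' 𝓜₁ ≤ (𝓢 ⊔ 𝓟)·𝒪 ⊔ St' 𝓠` — the φ_q tag upstairs.  (`O`, integrality and regularity are part of the pinned binder and not used.)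
[folklore; ideal-sheaf algebra] [OURS · L1 W4.5b · WIDTH TABLE D5, HOPEN (IN-3)] -/
theorem TCPlus.keyInc_carrierRound :
    ∀ (O : Type) [CommRing O] [IsDomain O] [IsDiscreteValuationRing O] {X₁ X₂ : Scheme.{0}} [IsIntegral X₁] [IsLocallyNoetherian X₁] [IsLocallyNoetherian X₂],
      Scheme.IsRegular X₁ → ∀ (𝓢 𝓟 𝓠 𝓜₁ : X₁.IdealSheafData) (a : ℕ) (τ' : X₂ ⟶ X₁), IsBlowup τ' (𝓢 ⊔ 𝓟) → 2 ≤ a →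
      𝓜₁ ≤ 𝓟 ^ a ⊔ 𝓟 * 𝓢 ⊔ 𝓢 * 𝓠 → 𝓜₁.comap τ' = (𝓢 ⊔ 𝓟).comap τ' ^ 1 * strictTransformIdeal τ' (𝓢 ⊔ 𝓟) 𝓜₁ →
      strictTransformIdeal τ' (𝓢 ⊔ 𝓟) 𝓜₁ ≤ (𝓢 ⊔ 𝓟).comap τ' ⊔ strictTransformIdeal τ' (𝓢 ⊔ 𝓟) 𝓠 := by
  intro _ _ _ _ X₁ X₂ _ _ _ _ 𝓢 𝓟 𝓠 𝓜₁ a τ' hτ' ha hInc hfac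
  exact keyInc_carrierRound_of_factorization τ' 𝓢 𝓟 𝓠 𝓜₁ ha hτ'.isEffectiveCartier hInc hfac

end Summit.ResolutionOfSingularities.ResolutionOfSingularities.Cruxes.EquisingularLiftNat.Sections

end
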